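import Mathlib
import Literature.Analysis.FluidPDE.ClassicalSolution
import Literature.Analysis.FluidPDE.LerayHopf
import Literature.Analysis.FluidPDE.SuitableWeak
import Literature.Analysis.FluidPDE.TaoLocalisation
import Summits.NavierStokesRegularity.NavierStokesRegularity.Theses.L3TimeExponentPincer
import Summits.NavierStokesRegularity.NavierStokesRegularity.Theorems.L3TimeExponentPincerEffNode
import Summits.NavierStokesRegularity.NavierStokesRegularity.Theorems.L3TimeExponentPincerSmoothBranch
import Summits.NavierStokesRegularity.NavierStokesRegularity.Theorems.TypeICertificateLadderTypeIConcentration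
import HarnessLib.Audit
import HarnessLib

/-!
# Type-I rung for the hard child `EffSatBlowup` of crux `L3CascadeJaw` (route `L3TimeExponentPincer`):
# every Type-I blow-up is an `L³`-effectively FAT cascade at every exchange rate `σ`

Support file for `stmt-NavierStokesRegularity-19139` (`EffSatBlowup`, the hard child of the split of
`stmt-NavierStokesRegularity-19499` `L3CascadeJaw`; cell ns-regularity-ideate, seat p4).

**What is proved (0 `sorry`, unconditional).**  In the route's Leray–Hopf frame (classical solution on
`[0,T)`, Leray–Hopf from a rapidly decaying datum), a solution with NO smooth extension past `T` that is
sup-norm TYPE I at `T` (`Literature.Analysis.FluidPDE.IsTypeIBlowup u T`, `‖u(t,x)‖ ≤ C/√(T-t)` near `T`)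
satisfies the `L³`-effective saturation node `K₃(σ)` = `EffSaturatesAt σ u T` of
`Theorems.L3TimeExponentPincerEffNode` for EVERY `σ : ℝ` (`effSaturatesAt_of_typeI_blowup`).  Hence

* `effScaleSaturationB_of_typeI` — "every frame blow-up is Type I" ⇒ `EffScaleSaturationB σ` for all `σ`;
* `effSatBlowup_of_typeI` — the same hypothesis ⇒ the route item `…Theses.L3TimeExponentPincer.EffSatBlowup`
  BY NAME (the child crux is DECIDED, true, in the Type-I regime);
* `effSatBlowup_of_noTypeII`, `l3CascadeJaw_of_noTypeII` — the hypothesis is VERBATIM the shared hard core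
  `…Theses.TypeICertificateLadder.NoTypeII` (= `stmt-NavierStokesRegularity-0056`, Leray's "no Type II blow-up"
  question), so both the child `EffSatBlowup` (19139) and the parent `L3CascadeJaw` (19499) sit BELOW that hard
  core: `NoTypeII → EffSatBlowup → L3CascadeJaw`.  This sharpens the route's BC5 rung
  `Theorems.L3TimeExponentPincerTypeIRung.L3CascadeJaw_of_typeI` (there Type I is demanded of every frame
  solution; here only of the blow-ups, and the conclusion is the stronger node).

**Mechanism.**  The one deep input is the tree theorem
`Summit.NavierStokesRegularity.NavierStokesRegularity.Theorems.typeIConcentration_proof` (crux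
`TypeIConcentration` of route `TypeICertificateLadder`, PROVED in the tree from Barker–Prange 2020 Thm 2,
`BarkerPrange2020_thm2_holds`, and the uniform Morrey bound `scaledEnergyBound_proof` à la Seregin–Šverák 2009
Lemma 3.5): at a Type-I(`C`) blow-up there is a centre `x₀` with `γ ν³ ≤ ∫_{B(x₀, ρ√(ν(T-t)))} |u(t)|³` for all
late `t`.  With the pointwise rate `|u(t)| ≤ C'/√(T-t)` this gives PARABOLIC `L²`-CONCENTRATION
`∫_{B(x₀, c√(T-t))} |u(t)|² ≥ γ' √(T-t)` (`parabolicConcentration_of_typeI_blowup`; the printed shape of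
Kang–Miura–Tsai 2021 Thm 1.6 (i) / Bradshaw–Tsai), and then the effective speed `U := C'/√(T-t)`, the radius
`r := c√(T-t) = R₀ U^{2σ-1}(T-t)^σ` (`R₀ := c/C'^{2σ-1}`) and `m := γ'/(C'² c³)` realise `K₃(σ)`; the `L³` clause
`‖u(t)‖₃³ ≤ U · 2E(u₀)` is the energy inequality (`IsLerayHopfOn.lintegral_enorm_sq_le`).  The exponent
bookkeeping is that of the cell's evidence file `run/shared/lean/pub/ns-regularity-ideate/ns-regularity-ideate-p2/
EffLadder.lean` (`saturatesAt_of_typeI`, there modulo a `ParabolicConcentration` hypothesis — discharged here).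

**Why this is a witness of weakness for the child crux (tribunal T3 / BC5).**  Excluding Type-I blow-up is
hard core 0056 (open); yet `EffSatBlowup` is TRUE there.  The child constrains only blow-ups cascading SLOWER
than Euler speed or leaking/idling (nsreg-p2 ROUND-7 §4) — regimes disjoint from Type I.

WHAT THIS IS NOT: not a claim about Navier–Stokes regularity or blow-up; no crux is closed; every statement here
is an implication between typed tree predicates, kernel-checked, landed `--supports`.
-/

noncomputable section

namespace Summit.NavierStokesRegularity.NavierStokesRegularity.Theorems.L3TimeExponentPincerEffSatTypeIRung

open MeasureTheory Set Filter Metric Function Topology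
open scoped ENNReal NNReal Topology
open Literature.Analysis.FluidPDE
open Summit.NavierStokesRegularity.NavierStokesRegularity.Theorems.L3TimeExponentPincerEffNode
open Summit.NavierStokesRegularity.NavierStokesRegularity.Theorems.L3TimeExponentPincerSmoothBranch

/-! ## §1  One time slice: `L³` mass in a ball + a pointwise bound ⇒ `L²` mass in the same ball -/

/-- If `|v| ≤ a` pointwise (`a > 0`) and the Bochner integral `∫_{B(x₀,R)} |v|³` is at least `G > 0`, then
`∫⁻_{B(x₀,R)} ‖v‖ₑ² ≥ G/a` (the positivity of `G` forces integrability of `|v|³` on the ball, so the Bochner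
integral is the lower Lebesgue integral; then `|v|³ ≤ a |v|²`). -/
theorem ofReal_div_le_lintegral_ball_sq_of_l3
    {v : (EuclideanSpace ℝ (Fin 3)) → (EuclideanSpace ℝ (Fin 3))} {x₀ : EuclideanSpace ℝ (Fin 3)} {R a G : ℝ}
    (ha : 0 < a) (hG : 0 < G) (hv : ∀ x, ‖v x‖ ≤ a)
    (hconc : G ≤ ∫ x in ball x₀ R, ‖v x‖ ^ 3) :
    ENNReal.ofReal (G / a) ≤ ∫⁻ x in ball x₀ R, ‖v x‖ₑ ^ 2 := by
  have hint : Integrable (fun x => ‖v x‖ ^ 3) (volume.restrict (ball x₀ R)) := by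
    by_contra h
    have h0 : ∫ x in ball x₀ R, ‖v x‖ ^ 3 = 0 := integral_undef h
    linarith
  have h1 : ENNReal.ofReal G ≤ ∫⁻ x in ball x₀ R, ENNReal.ofReal (‖v x‖ ^ 3) := by
    rw [← ofReal_integral_eq_lintegral_ofReal hint (ae_of_all _ fun x => by positivity)]
    exact ENNReal.ofReal_le_ofReal hconc
  have h2 : ∫⁻ x in ball x₀ R, ENNReal.ofReal (‖v x‖ ^ 3) ≤
      ENNReal.ofReal a * ∫⁻ x in ball x₀ R, ‖v x‖ₑ ^ 2 := by
    rw [← lintegral_const_mul' _ _ ENNReal.ofReal_ne_top]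
    refine lintegral_mono fun x => ?_
    have hx : ENNReal.ofReal (‖v x‖ ^ 3) = ‖v x‖ₑ * ‖v x‖ₑ ^ 2 := by
      rw [ENNReal.ofReal_pow (norm_nonneg _), ofReal_norm]
      ring
    rw [hx]
    gcongr
    rw [← ofReal_norm]
    exact ENNReal.ofReal_le_ofReal (hv x)
  rw [ENNReal.ofReal_div_of_pos ha]
  exact ENNReal.div_le_of_le_mul' (h1.trans h2)

/-! ## §2  Parabolic `L²`-concentration at a Type-I blow-up (tree crux `TypeIConcentration`, PROVED) -/

/-- **Parabolic `L²`-concentration for Type-I blow-ups in the route's frame.**  A classical solution on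
`[0,T)`, Leray–Hopf from a rapidly decaying datum, sup-norm Type I at `T` and with NO smooth extension past `T`,
carries on a final window `(T₁,T)` a pointwise bound `|u(t,x)| ≤ C/√(T-t)` (`C > 0`) AND, around a FIXED
centre `x₀`, the `L²`-mass `∫⁻_{B(x₀, c√(T-t))} |u(t)|² ≥ γ √(T-t)` (`γ, c > 0`).  Input: the tree theorem
`typeIConcentration_proof` (Barker–Prange 2020 Thm 2 + uniform Morrey bound) applied with the dimensionless
rate constant `C₁ = C/√ν`, then §1 on each slice. -/
theorem parabolicConcentration_of_typeI_blowup {ν T : ℝ} (hν : 0 < ν) (hT : 0 < T)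
    {u : ℝ → (EuclideanSpace ℝ (Fin 3)) → (EuclideanSpace ℝ (Fin 3))} {p : ℝ → (EuclideanSpace ℝ (Fin 3)) → ℝ}
    (hcl : IsClassicalNSSolutionOn (Ico 0 T) ν 0 u p) (hLH : IsLerayHopfOn T ν 0 (u 0) u)
    (hdec : HasRapidSpatialDecay (u 0)) (hTI : IsTypeIBlowup u T)
    (hmax : ¬ HasSmoothExtensionPast ν 0 u T) :
    ∃ C : ℝ, 0 < C ∧ ∃ γ : ℝ, 0 < γ ∧ ∃ c : ℝ, 0 < c ∧ ∃ x₀ : EuclideanSpace ℝ (Fin 3), ∃ T₁ < T,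
      ∀ t ∈ Ioo T₁ T,
        (∀ x, ‖u t x‖ ≤ C / Real.sqrt (T - t)) ∧
        ENNReal.ofReal (γ * Real.sqrt (T - t)) ≤
          ∫⁻ x in ball x₀ (c * Real.sqrt (T - t)), ‖u t x‖ₑ ^ 2 := by
  obtain ⟨C, hev⟩ := hTI
  set C' : ℝ := |C| + 1 with hC'
  have hC'pos : 0 < C' := by positivity
  have hCC' : C ≤ C' := (le_abs_self C).trans (by linarith)
  have hsν : 0 < Real.sqrt ν := Real.sqrt_pos.2 hν
  -- the dimensionless rate form consumed by `TypeIConcentration`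
  set C₁ : ℝ := C' / Real.sqrt ν with hC₁
  have hC₁pos : 0 < C₁ := by positivity
  have hC₁ν : C₁ * Real.sqrt ν = C' := by rw [hC₁, div_mul_cancel₀ _ hsν.ne']
  have hrate : ∀ᶠ t in 𝓝[<] T, ∀ x, Real.sqrt (T - t) * ‖u t x‖ ≤ C₁ * Real.sqrt ν := by
    have hlt : ∀ᶠ t in 𝓝[<] T, t < T := eventually_nhdsWithin_of_forall fun t ht => ht
    filter_upwards [hev, hlt] with t ht htT x
    have hs : 0 < Real.sqrt (T - t) := Real.sqrt_pos.2 (sub_pos.2 htT)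
    have hs' : Real.sqrt (T - t) ≠ 0 := hs.ne'
    have h1 : ‖u t x‖ ≤ C' / Real.sqrt (T - t) :=
      (ht x).trans (div_le_div_of_nonneg_right hCC' hs.le)
    calc Real.sqrt (T - t) * ‖u t x‖ ≤ Real.sqrt (T - t) * (C' / Real.sqrt (T - t)) := by gcongr
      _ = C' := by field_simp
      _ = C₁ * Real.sqrt ν := hC₁ν.symm
  obtain ⟨ρ, hρ, γ, hγ, hconc⟩ :=
    Summit.NavierStokesRegularity.NavierStokesRegularity.Theorems.typeIConcentration_proof C₁ hC₁pos
  obtain ⟨x₀, hx₀⟩ := hconc ν T hν hT u p hcl hLH hdec hrate hmax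
  -- a common final window for the pointwise rate and the concentration
  obtain ⟨l, hlT, hl⟩ := (mem_nhdsLT_iff_exists_Ioo_subset).1 (hev.and hx₀)
  refine ⟨C', hC'pos, γ * ν ^ 3 / C', by positivity, ρ * Real.sqrt ν, by positivity, x₀, l, hlT,
    fun t ht => ?_⟩
  obtain ⟨hpt, hct⟩ := hl ht
  have hs : 0 < Real.sqrt (T - t) := Real.sqrt_pos.2 (sub_pos.2 ht.2)
  have hptC' : ∀ x, ‖u t x‖ ≤ C' / Real.sqrt (T - t) := fun x =>
    (hpt x).trans (div_le_div_of_nonneg_right hCC' hs.le)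
  refine ⟨hptC', ?_⟩
  have hrad : ρ * Real.sqrt (ν * (T - t)) = ρ * Real.sqrt ν * Real.sqrt (T - t) := by
    rw [Real.sqrt_mul hν.le, mul_assoc]
  have h := ofReal_div_le_lintegral_ball_sq_of_l3 (by positivity : 0 < C' / Real.sqrt (T - t))
    (by positivity : 0 < γ * ν ^ 3) hptC' hct
  rw [hrad] at h
  refine (le_of_eq ?_).trans h
  rw [div_mul_eq_mul_div, div_div_eq_mul_div]

/-! ## §3  `K₃(σ)` for Type-I blow-ups, every `σ` -/

/-- **Type-I blow-ups satisfy `K₃(σ)` for every `σ`.**  With the data of §2: effective speed `U := C/√(T-t)`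
(`‖u(t)‖₃³ ≤ U · 2E(u₀) ≤ (2E(u₀)+1) · U` by the energy inequality), radius `r := c√(T-t)`, which equals the
causal scale `R₀ U^{2σ-1} (T-t)^σ` for `R₀ := c/C^{2σ-1}`, and fatness constant `m := γ/(C² c³)`, for which
`m U² r³ = γ√(T-t)`.  Unconditional. -/
theorem effSaturatesAt_of_typeI_blowup {ν T : ℝ} (hν : 0 < ν) (hT : 0 < T)
    {u : ℝ → (EuclideanSpace ℝ (Fin 3)) → (EuclideanSpace ℝ (Fin 3))} {p : ℝ → (EuclideanSpace ℝ (Fin 3)) → ℝ}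
    (hcl : IsClassicalNSSolutionOn (Ico 0 T) ν 0 u p) (hLH : IsLerayHopfOn T ν 0 (u 0) u)
    (hdec : HasRapidSpatialDecay (u 0)) (hTI : IsTypeIBlowup u T)
    (hmax : ¬ HasSmoothExtensionPast ν 0 u T) (σ : ℝ) : EffSaturatesAt σ u T := by
  obtain ⟨C, hC, γ, hγ, c, hc, x₀, T₁, hT₁, hwin⟩ :=
    parabolicConcentration_of_typeI_blowup hν hT hcl hLH hdec hTI hmax
  set E2 : ℝ := 2 * VectorCalculus.kineticEnergy (u 0) with hE2
  have hE2nn : 0 ≤ E2 :=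
    mul_nonneg zero_le_two (Literature.Analysis.FluidPDE.kineticEnergy_nonneg _)
  refine ⟨γ / (C ^ 2 * c ^ 3), by positivity, c / C ^ (2 * σ - 1), by positivity, E2 + 1,
    by positivity, max T₁ 0, max_lt hT₁ hT, fun t ht => ?_⟩
  have ht₁ : t ∈ Ioo T₁ T := ⟨lt_of_le_of_lt (le_max_left _ _) ht.1, ht.2⟩
  have ht0 : t ∈ Icc 0 T := ⟨(le_max_right T₁ 0).trans ht.1.le, ht.2.le⟩
  have hs : 0 < T - t := sub_pos.2 ht.2
  have hsq : 0 < Real.sqrt (T - t) := Real.sqrt_pos.2 hs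
  obtain ⟨hpt, hconc⟩ := hwin t ht₁
  set U : ℝ := C / Real.sqrt (T - t) with hU
  have hUpos : 0 < U := by positivity
  refine ⟨U, hUpos.le, ?_, x₀, c * Real.sqrt (T - t), le_of_eq ?_, ?_⟩
  · -- the `L³` clause: `‖u(t)‖₃³ ≤ U · ∫|u(t)|² ≤ U · 2E(u₀) ≤ (2E(u₀)+1) · U`
    have hEt : ∫⁻ x, ‖u t x‖ₑ ^ 2 ≤ ENNReal.ofReal E2 := hLH.lintegral_enorm_sq_le hν.le ht0
    calc eLpNorm (u t) 3 volume ^ (3 : ℝ)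
        ≤ ENNReal.ofReal U * ∫⁻ x, ‖u t x‖ₑ ^ 2 := eLpNorm_three_rpow_three_le_of_forall_le hpt
      _ ≤ ENNReal.ofReal U * ENNReal.ofReal E2 := by gcongr
      _ = ENNReal.ofReal (U * E2) := (ENNReal.ofReal_mul hUpos.le).symm
      _ ≤ ENNReal.ofReal ((E2 + 1) * U) := ENNReal.ofReal_le_ofReal (by nlinarith [hUpos.le, hE2nn])
  · -- the scale clause: `R₀ U^{2σ-1} (T-t)^σ = c √(T-t)`
    have hA : C ^ (2 * σ - 1) ≠ 0 := (Real.rpow_pos_of_pos hC _).ne'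
    have hB' : Real.sqrt (T - t) ^ (2 * σ - 1) ≠ 0 := (Real.rpow_pos_of_pos hsq _).ne'
    have hB : Real.sqrt (T - t) ^ (2 * σ - 1) * Real.sqrt (T - t) = (T - t) ^ σ := by
      rw [Real.sqrt_eq_rpow, ← Real.rpow_mul hs.le, ← Real.rpow_add hs]
      congr 1
      ring
    rw [hU, Real.div_rpow hC.le hsq.le, ← hB]
    field_simp
  · -- the energy clause: `m U² r³ = γ √(T-t) ≤ ∫_{B(x₀, c√(T-t))} |u(t)|²`
    have h3 : γ / (C ^ 2 * c ^ 3) * (U ^ 2 * (c * Real.sqrt (T - t)) ^ 3) =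
        γ * Real.sqrt (T - t) := by
      rw [hU, div_pow, mul_pow, Real.sq_sqrt hs.le,
        show Real.sqrt (T - t) ^ 3 = Real.sqrt (T - t) ^ 2 * Real.sqrt (T - t) by ring,
        Real.sq_sqrt hs.le]
      field_simp
    rw [h3]
    exact hconc

/-! ## §4  The rungs BY NAME: `NoTypeII → EffSatBlowup → L3CascadeJaw` -/

/-- **"Every frame blow-up is Type I" ⇒ `K₃(σ)` on the blow-up branch (`EffScaleSaturationB σ`), every `σ`.** -/
theorem effScaleSaturationB_of_typeI
    (hTI : ∀ (ν T : ℝ), 0 < ν → 0 < T →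
      ∀ (u : ℝ → (EuclideanSpace ℝ (Fin 3)) → (EuclideanSpace ℝ (Fin 3))) (p : ℝ → (EuclideanSpace ℝ (Fin 3)) → ℝ),
      IsClassicalNSSolutionOn (Ico 0 T) ν 0 u p → IsLerayHopfOn T ν 0 (u 0) u →
      HasRapidSpatialDecay (u 0) → ¬ HasSmoothExtensionPast ν 0 u T → IsTypeIBlowup u T)
    (σ : ℝ) : EffScaleSaturationB σ :=
  fun ν T hν hT u p hcl hLH hdec hmax =>
    effSaturatesAt_of_typeI_blowup hν hT hcl hLH hdec (hTI ν T hν hT u p hcl hLH hdec hmax) hmax σ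

/-- **TYPE-I RUNG OF THE CHILD CRUX.**  "Every frame blow-up is Type I" ⇒ the route item
`…Theses.L3TimeExponentPincer.EffSatBlowup` (`stmt-NavierStokesRegularity-19139`) BY NAME. -/
theorem effSatBlowup_of_typeI
    (hTI : ∀ (ν T : ℝ), 0 < ν → 0 < T →
      ∀ (u : ℝ → (EuclideanSpace ℝ (Fin 3)) → (EuclideanSpace ℝ (Fin 3))) (p : ℝ → (EuclideanSpace ℝ (Fin 3)) → ℝ),
      IsClassicalNSSolutionOn (Ico 0 T) ν 0 u p → IsLerayHopfOn T ν 0 (u 0) u →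
      HasRapidSpatialDecay (u 0) → ¬ HasSmoothExtensionPast ν 0 u T → IsTypeIBlowup u T) :
    Summit.NavierStokesRegularity.NavierStokesRegularity.Theses.L3TimeExponentPincer.EffSatBlowup :=
  effScaleSaturationB_one_iff_stub.1 (effScaleSaturationB_of_typeI hTI 1)

/-- **The child crux sits below hard core 0056**: the shared crux `NoTypeII` of route `TypeICertificateLadder`
(`stmt-NavierStokesRegularity-0056`: every maximal classical Leray–Hopf solution from a rapidly decaying datum
is Type I at its maximal time) implies `EffSatBlowup` (`stmt-NavierStokesRegularity-19139`). -/
theorem effSatBlowup_of_noTypeII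
    (h : Summit.NavierStokesRegularity.NavierStokesRegularity.Theses.TypeICertificateLadder.NoTypeII) :
    Summit.NavierStokesRegularity.NavierStokesRegularity.Theses.L3TimeExponentPincer.EffSatBlowup :=
  effSatBlowup_of_typeI fun ν T hν hT u p hcl hLH hdec hmax => h ν T hν hT u p ⟨hcl, hmax⟩ hLH hdec

/-- **… and so does the parent crux**: `NoTypeII` (`stmt-0056`) ⇒ `L3CascadeJaw` (`stmt-19499`), through the
landed one-stub composition `l3CascadeJaw_of_effSatBlowup` (smooth branch = `jawSmoothBranch_holds`).  This
sharpens `Theorems.L3TimeExponentPincerTypeIRung.L3CascadeJaw_of_typeI` (Type I demanded of blow-ups only). -/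
theorem l3CascadeJaw_of_noTypeII
    (h : Summit.NavierStokesRegularity.NavierStokesRegularity.Theses.TypeICertificateLadder.NoTypeII) :
    Summit.NavierStokesRegularity.NavierStokesRegularity.Theses.L3TimeExponentPincer.L3CascadeJaw :=
  l3CascadeJaw_of_effSatBlowup (effSatBlowup_of_noTypeII h)

/-- The parent rung with the weaker (blow-up-only) Type-I hypothesis, spelled out without the cross-route name. -/
theorem l3CascadeJaw_of_typeI_blowup
    (hTI : ∀ (ν T : ℝ), 0 < ν → 0 < T →
      ∀ (u : ℝ → (EuclideanSpace ℝ (Fin 3)) → (EuclideanSpace ℝ (Fin 3))) (p : ℝ → (EuclideanSpace ℝ (Fin 3)) → ℝ),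
      IsClassicalNSSolutionOn (Ico 0 T) ν 0 u p → IsLerayHopfOn T ν 0 (u 0) u →
      HasRapidSpatialDecay (u 0) → ¬ HasSmoothExtensionPast ν 0 u T → IsTypeIBlowup u T) :
    Summit.NavierStokesRegularity.NavierStokesRegularity.Theses.L3TimeExponentPincer.L3CascadeJaw :=
  l3CascadeJaw_of_effSatBlowup (effSatBlowup_of_typeI hTI)

end Summit.NavierStokesRegularity.NavierStokesRegularity.Theorems.L3TimeExponentPincerEffSatTypeIRung

end
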